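import Summits.Ventures.PercRepro.CoreCountWrapper
import Summits.Ventures.PercRepro.RankLevelSetDenseSplit

/-!
# PercRepro — nullity on the coloop-free core at corank `4` (p2, gen 12)

The set-level facts behind the kernel closure of the corank-`4` cell of `SmallCoreCells''`. Throughout, the core is
the hypothesis of the wrapper `ThmN.rls_succ_all`: simple (`hs`: pairs have rank `2`), with (C1) lines of `≤ 3` points
(`hC1`, from `RankLevelSetCoreSparse`), coloop-free, of corank `4` (`|E| = r(E) + 4`).

* `exists_eRk_eq_nat` — ranks are natural numbers in a finite matroid;
* `two_le_eRk_of_two_le_ncard`, `three_le_eRk_of_four_le_ncard`, `ncard_le_eRk_add_two` — `≥ 2` points have rank `≥ 2`,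
  `≥ 4` points have rank `≥ 3` under (C1), so `≤ 5` points have nullity `≤ 2`;
* `encard_le_eRk_add_of_ground` — nullity is monotone (`|S| ≤ r(S) + d` when `|E| = r(E) + d`);
* **`eq_ground_of_encard_eq_eRk_add`** — a set of FULL nullity in a coloop-free matroid is the ground set (every point
  outside it would be a coloop: `r(E ∖ {e}) ≤ r(Z) + |E ∖ Z| − 1 = r(E) − 1`);
* `ncard_le_six_of_eRk_le_three` — on the coloop-free core at corank `4` with `|E| ≥ 8`, sets of rank `≤ 3` have `≤ 6`
  points; **`ncard_six_sets_le_one`** — and with `|E| ≥ 13` there is at most ONE `6`-set of rank `≤ 3` (two of them have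
  `ν(X ∩ Y) ≤ 2`, so `ν(X ∪ Y) ≥ 3 + 3 − 2 = 4` by submodularity — full nullity — so `X ∪ Y = E`, `|E| ≤ 12`);
* `subset_sUnion_of_five_le` — on the core a set of rank `≤ 3` with `≥ 5` points lies in
  `S₀ = ⋃ {circuits with ≤ 4 elements}` (Lemma 13.5 of RankLevelSetDenseSplit and (C1)).
Imports `CoreCountWrapper`, `RankLevelSetDenseSplit`. Axioms: standard.
-/

namespace PercRepro
namespace CoreFour

open Set

variable {α : Type} {M : Matroid α}

/-! ### Ranks as natural numbers -/

/-- In a finite matroid every set has a natural-number rank. -/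
theorem exists_eRk_eq_nat [M.Finite] (X : Set α) : ∃ r : ℕ, M.eRk X = (r : ℕ∞) := by
  have hR : M.eRank ≠ ⊤ := (Matroid.eRank_ne_top_iff M).2 inferInstance
  have h : M.eRk X ≠ ⊤ := ne_top_of_le_ne_top hR (M.eRk_le_eRank X)
  obtain ⟨r, hr⟩ := ENat.ne_top_iff_exists.1 h
  exact ⟨r, hr.symm⟩

/-- Two distinct points of a simple matroid have rank `2`, so a set with `≥ 2` points has rank `≥ 2`. -/
theorem two_le_eRk_of_two_le_ncard [M.Finite] (hs : ∀ e ∈ M.E, ∀ f ∈ M.E, e ≠ f → M.eRk {e, f} = 2)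
    {Y : Set α} (hY : Y ⊆ M.E) (h2 : 2 ≤ Y.ncard) : 2 ≤ M.eRk Y := by
  have hYfin : Y.Finite := M.ground_finite.subset hY
  obtain ⟨e, f, he, hf, hef⟩ := (Set.one_lt_ncard_iff hYfin).1 (by omega)
  have h := hs e (hY he) f (hY hf) hef
  rw [← h]
  exact M.eRk_mono (Set.pair_subset he hf)

/-- Under (C1) a set with `≥ 4` points has rank `≥ 3`. -/
theorem three_le_eRk_of_four_le_ncard [M.Finite] (hs : ∀ e ∈ M.E, ∀ f ∈ M.E, e ≠ f → M.eRk {e, f} = 2)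
    (hC1 : ∀ L ⊆ M.E, M.eRk L = 2 → L.ncard ≤ 3)
    {Y : Set α} (hY : Y ⊆ M.E) (h4 : 4 ≤ Y.ncard) : 3 ≤ M.eRk Y := by
  obtain ⟨r, hr⟩ := exists_eRk_eq_nat (M := M) Y
  have h2 := two_le_eRk_of_two_le_ncard hs hY (by omega)
  rw [hr] at h2 ⊢
  have h2' : 2 ≤ r := by exact_mod_cast h2
  by_contra hlt
  have hlt' : r < 3 := by exact_mod_cast (not_le.1 hlt)
  have hr2 : r = 2 := by omega
  rw [hr2] at hr
  have := hC1 Y hY (by rw [hr]; rfl)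
  omega

/-- Under (C1) in a simple matroid, a set with `≤ 5` points has nullity `≤ 2`: `|W| ≤ r(W) + 2`. -/
theorem ncard_le_eRk_add_two [M.Finite] (hs : ∀ e ∈ M.E, ∀ f ∈ M.E, e ≠ f → M.eRk {e, f} = 2)
    (hC1 : ∀ L ⊆ M.E, M.eRk L = 2 → L.ncard ≤ 3)
    {W : Set α} (hW : W ⊆ M.E) (h5 : W.ncard ≤ 5) : (W.ncard : ℕ∞) ≤ M.eRk W + 2 := by
  obtain ⟨r, hr⟩ := exists_eRk_eq_nat (M := M) W
  rw [hr]
  have key : W.ncard ≤ r + 2 := by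
    rcases Nat.lt_or_ge W.ncard 2 with hlt | hge
    · omega
    rcases Nat.lt_or_ge W.ncard 4 with hlt4 | hge4
    · have := two_le_eRk_of_two_le_ncard hs hW hge
      rw [hr] at this
      have : 2 ≤ r := by exact_mod_cast this
      omega
    · have := three_le_eRk_of_four_le_ncard hs hC1 hW hge4
      rw [hr] at this
      have : 3 ≤ r := by exact_mod_cast this
      omega
  exact_mod_cast key

/-! ### Nullity: monotone, and full nullity forces the ground set (coloop-free) -/

/-- **Nullity is monotone**: `|E| = r(E) + d` gives `|S| ≤ r(S) + d` for every `S ⊆ E`. -/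
theorem encard_le_eRk_add_of_ground [M.Finite] {S : Set α} (hS : S ⊆ M.E) {d : ℕ}
    (hd : M.E.encard = M.eRank + d) : S.encard ≤ M.eRk S + d := by
  have h1 : M.eRank ≤ M.eRk S + (M.E \ S).encard := by
    rw [← M.eRk_ground]
    calc M.eRk M.E = M.eRk (S ∪ (M.E \ S)) := by rw [union_sdiff_cancel hS]
      _ ≤ M.eRk S + M.eRk (M.E \ S) := M.eRk_union_le_eRk_add_eRk S (M.E \ S)
      _ ≤ M.eRk S + (M.E \ S).encard := by gcongr; exact M.eRk_le_encard _
  have h2 : S.encard + (M.E \ S).encard = M.E.encard := by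
    rw [add_comm]; exact Set.encard_sdiff_add_encard_of_subset hS
  have hfin : (M.E \ S).encard ≠ ⊤ := (M.ground_finite.subset sdiff_subset).encard_lt_top.ne
  have h3 : S.encard + (M.E \ S).encard ≤ (M.eRk S + d) + (M.E \ S).encard := by
    rw [h2, hd]
    calc M.eRank + d ≤ (M.eRk S + (M.E \ S).encard) + d := by gcongr
      _ = (M.eRk S + d) + (M.E \ S).encard := by ring
  exact (WithTop.add_le_add_iff_right hfin).1 h3

/-- **Full nullity forces the ground set in a coloop-free matroid**: if `|E| = r(E) + d` and `Z ⊆ E` has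
`|Z| = r(Z) + d`, then every `e ∈ E ∖ Z` is a coloop (`r(E ∖ {e}) ≤ r(Z) + |E ∖ Z| − 1 = r(E) − 1`); so
without coloops `Z = E`. -/
theorem eq_ground_of_encard_eq_eRk_add [M.Finite] (hcoloop : ∀ e, ¬ M.IsColoop e) {Z : Set α} (hZ : Z ⊆ M.E)
    {d : ℕ} (hd : M.E.encard = M.eRank + d) (hZd : Z.encard = M.eRk Z + d) : Z = M.E := by
  classical
  by_contra hne
  obtain ⟨e, heE, heZ⟩ : ∃ e ∈ M.E, e ∉ Z := by
    by_contra hall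
    push Not at hall
    exact hne (Set.Subset.antisymm hZ hall)
  apply hcoloop e
  rw [Matroid.isColoop_iff_notMem_closure_compl heE]
  intro hecl
  -- `r(E ∖ {e}) = r(E)` since `e ∈ cl(E ∖ {e})`
  have hrE : M.eRk (M.E \ {e}) = M.eRank := by
    have h1 : M.eRk M.E ≤ M.eRk (M.closure (M.E \ {e})) := by
      apply M.eRk_mono
      intro x hx
      by_cases hxe : x = e
      · rw [hxe]; exact hecl
      · exact M.subset_closure (M.E \ {e}) (by simp [heE]) ⟨hx, hxe⟩
    rw [M.eRk_closure_eq, M.eRk_ground] at h1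
    exact le_antisymm (M.eRk_le_eRank _) h1
  -- but `r(E ∖ {e}) ≤ r(Z) + |E ∖ {e} ∖ Z| = r(Z) + |E ∖ Z| − 1 = r(E) − 1`
  have hsplit : M.E \ {e} = Z ∪ ((M.E \ {e}) \ Z) := by
    rw [Set.union_sdiff_cancel]
    intro x hx
    exact ⟨hZ hx, by rintro rfl; exact heZ hx⟩
  have hle : M.eRk (M.E \ {e}) ≤ M.eRk Z + ((M.E \ {e}) \ Z).encard := by
    calc M.eRk (M.E \ {e}) = M.eRk (Z ∪ ((M.E \ {e}) \ Z)) := by rw [← hsplit]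
      _ ≤ M.eRk Z + M.eRk ((M.E \ {e}) \ Z) := M.eRk_union_le_eRk_add_eRk _ _
      _ ≤ M.eRk Z + ((M.E \ {e}) \ Z).encard := by gcongr; exact M.eRk_le_encard _
  -- cardinalities
  have hEfin : M.E.Finite := M.ground_finite
  have hZfin : Z.Finite := hEfin.subset hZ
  have hcard : ((M.E \ {e}) \ Z).encard + 1 = (M.E \ Z).encard := by
    have h1 : (M.E \ Z) = insert e ((M.E \ {e}) \ Z) := by
      ext x
      simp only [Set.mem_sdiff, Set.mem_singleton_iff, Set.mem_insert_iff]
      constructor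
      · rintro ⟨hxE, hxZ⟩
        by_cases hxe : x = e
        · exact Or.inl hxe
        · exact Or.inr ⟨⟨hxE, hxe⟩, hxZ⟩
      · rintro (rfl | ⟨⟨hxE, _⟩, hxZ⟩)
        · exact ⟨heE, heZ⟩
        · exact ⟨hxE, hxZ⟩
    rw [h1, Set.encard_insert_of_notMem (by simp)]
  have hEZ : Z.encard + (M.E \ Z).encard = M.E.encard := by
    rw [add_comm]; exact Set.encard_sdiff_add_encard_of_subset hZ
  -- to natural numbers
  obtain ⟨rZ, hrZ⟩ := exists_eRk_eq_nat (M := M) Z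
  obtain ⟨rE, hrE'⟩ : ∃ rE : ℕ, M.eRank = (rE : ℕ∞) := by
    have hR : M.eRank ≠ ⊤ := (Matroid.eRank_ne_top_iff M).2 inferInstance
    obtain ⟨r, hr⟩ := ENat.ne_top_iff_exists.1 hR
    exact ⟨r, hr.symm⟩
  have hfin1 : ((M.E \ {e}) \ Z).Finite := hEfin.subset (sdiff_subset.trans sdiff_subset)
  have hfin2 : (M.E \ Z).Finite := hEfin.subset sdiff_subset
  rw [← hfin1.cast_ncard_eq] at hcard hle
  rw [← hfin2.cast_ncard_eq] at hcard hEZ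
  rw [← hZfin.cast_ncard_eq] at hZd hEZ
  rw [← hEfin.cast_ncard_eq] at hd hEZ
  rw [hrZ] at hZd hle
  rw [hrE'] at hd hrE
  rw [hrE] at hle
  have e1 : ((M.E \ {e}) \ Z).ncard + 1 = (M.E \ Z).ncard := by exact_mod_cast hcard
  have e2 : Z.ncard + (M.E \ Z).ncard = M.E.ncard := by exact_mod_cast hEZ
  have e3 : Z.ncard = rZ + d := by exact_mod_cast hZd
  have e4 : M.E.ncard = rE + d := by exact_mod_cast hd
  have e5 : rE ≤ rZ + ((M.E \ {e}) \ Z).ncard := by exact_mod_cast hle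
  omega

/-! ### Sets of rank `≤ 3` on the coloop-free core at corank `4` -/

/-- On the coloop-free core at corank `4` with `|E| ≥ 8`, a set of rank `≤ 3` has at most `6` points
(a `7`-set of rank `≤ 3` has nullity `≥ 4`, the full nullity, so it is `E`). -/
theorem ncard_le_six_of_eRk_le_three [M.Finite] (hcoloop : ∀ e, ¬ M.IsColoop e)
    (hd : M.E.encard = M.eRank + 4) (hn : 8 ≤ M.E.ncard)
    {X : Set α} (hX : X ⊆ M.E) (hr : M.eRk X ≤ 3) : X.ncard ≤ 6 := by
  by_contra hlt
  push Not at hlt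
  have hXfin : X.Finite := M.ground_finite.subset hX
  obtain ⟨r, hr'⟩ := exists_eRk_eq_nat (M := M) X
  have hmono := encard_le_eRk_add_of_ground hX hd
  rw [← hXfin.cast_ncard_eq, hr'] at hmono
  rw [hr'] at hr
  have hr3 : r ≤ 3 := by exact_mod_cast hr
  have hX7 : X.ncard ≤ r + 4 := by exact_mod_cast hmono
  have hX7' : X.ncard = r + 4 := by omega
  have hfull : X.encard = M.eRk X + 4 := by
    rw [← hXfin.cast_ncard_eq, hr', hX7']; push_cast; rfl
  have hXE := eq_ground_of_encard_eq_eRk_add hcoloop hX hd hfull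
  rw [hXE] at hX7'
  omega

/-- **At most one `6`-set of rank `≤ 3`** on the coloop-free core at corank `4` with `|E| ≥ 13`: two distinct ones
`X ≠ Y` have `|X ∩ Y| ≤ 5`, hence `ν(X ∩ Y) ≤ 2`, hence `ν(X ∪ Y) ≥ 3 + 3 − 2 = 4` by submodularity; so `X ∪ Y = E`
and `|E| ≤ 12`. -/
theorem ncard_six_sets_le_one [M.Finite] (hs : ∀ e ∈ M.E, ∀ f ∈ M.E, e ≠ f → M.eRk {e, f} = 2)
    (hC1 : ∀ L ⊆ M.E, M.eRk L = 2 → L.ncard ≤ 3) (hcoloop : ∀ e, ¬ M.IsColoop e)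
    (hd : M.E.encard = M.eRank + 4) (hn : 13 ≤ M.E.ncard) :
    {X : Set α | X ⊆ M.E ∧ X.ncard = 6 ∧ M.eRk X ≤ 3}.ncard ≤ 1 := by
  classical
  have hEfin : M.E.Finite := M.ground_finite
  have hfin : {X : Set α | X ⊆ M.E ∧ X.ncard = 6 ∧ M.eRk X ≤ 3}.Finite :=
    hEfin.finite_subsets.subset (fun X hX => hX.1)
  rw [Set.ncard_le_one_iff hfin]
  intro X Y hX hY
  by_contra hXY
  obtain ⟨hXE, hX6, hXr⟩ := hX
  obtain ⟨hYE, hY6, hYr⟩ := hY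
  have hXfin : X.Finite := hEfin.subset hXE
  have hYfin : Y.Finite := hEfin.subset hYE
  -- `|X ∩ Y| ≤ 5`
  have hI5 : (X ∩ Y).ncard ≤ 5 := by
    by_contra h
    push Not at h
    have hsub : X ∩ Y ⊆ X := Set.inter_subset_left
    have heq : X ∩ Y = X := Set.eq_of_subset_of_ncard_le hsub (by omega) hXfin
    have hXY' : X ⊆ Y := by rw [← heq]; exact Set.inter_subset_right
    exact hXY (Set.eq_of_subset_of_ncard_le hXY' (by omega) hYfin)
  -- nullity of the intersection `≤ 2`
  have hIν := ncard_le_eRk_add_two hs hC1 (Set.inter_subset_left.trans hXE) hI5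
  -- submodularity
  have hsub := M.eRk_inter_add_eRk_union_le X Y
  -- nullity of the union is at most `4`
  have hUmono := encard_le_eRk_add_of_ground (Set.union_subset hXE hYE) hd
  -- inclusion–exclusion
  have hIE := Set.ncard_inter_add_ncard_union X Y hXfin hYfin
  -- to natural numbers
  obtain ⟨rX, hrX⟩ := exists_eRk_eq_nat (M := M) X
  obtain ⟨rY, hrY⟩ := exists_eRk_eq_nat (M := M) Y
  obtain ⟨rI, hrI⟩ := exists_eRk_eq_nat (M := M) (X ∩ Y)
  obtain ⟨rU, hrU⟩ := exists_eRk_eq_nat (M := M) (X ∪ Y)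
  have hUfin : (X ∪ Y).Finite := hXfin.union hYfin
  rw [hrX] at hXr hsub
  rw [hrY] at hYr hsub
  rw [hrI] at hIν hsub
  rw [hrU] at hsub hUmono
  rw [← hUfin.cast_ncard_eq] at hUmono
  have e1 : rX ≤ 3 := by exact_mod_cast hXr
  have e2 : rY ≤ 3 := by exact_mod_cast hYr
  have e3 : (X ∩ Y).ncard ≤ rI + 2 := by exact_mod_cast hIν
  have e4 : rI + rU ≤ rX + rY := by exact_mod_cast hsub
  have e5 : (X ∪ Y).ncard ≤ rU + 4 := by exact_mod_cast hUmono
  -- so `|X ∪ Y| = rU + 4`: full nullity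
  have hfull : (X ∪ Y).encard = M.eRk (X ∪ Y) + 4 := by
    rw [← hUfin.cast_ncard_eq, hrU]
    have : (X ∪ Y).ncard = rU + 4 := by omega
    rw [this]; push_cast; rfl
  have hUE := eq_ground_of_encard_eq_eRk_add hcoloop (Set.union_subset hXE hYE) hd hfull
  have : M.E.ncard ≤ 12 := by
    rw [← hUE]; omega
  omega

/-- **On the core a set of rank `≤ 3` with `≥ 5` points lies in `S₀ = ⋃ {circuits with ≤ 4 elements}`**:
by Lemma 13.5, `r(X) = r(X ∩ S₀) + |X ∖ S₀|`; a point outside `S₀` leaves `X ∩ S₀` of rank `≤ 2`, hence with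
`≤ 3` points by (C1), against `|X| ≥ 5`. -/
theorem subset_sUnion_of_five_le [M.Finite] (hs : ∀ e ∈ M.E, ∀ f ∈ M.E, e ≠ f → M.eRk {e, f} = 2)
    (hC1 : ∀ L ⊆ M.E, M.eRk L = 2 → L.ncard ≤ 3)
    {X : Set α} (hX : X ⊆ M.E) (hr : M.eRk X ≤ 3) (h5 : 5 ≤ X.ncard) :
    X ⊆ ⋃₀ PercRepro.Matroid.circuitsLE M 4 := by
  set S₀ := ⋃₀ PercRepro.Matroid.circuitsLE M 4 with hS₀
  have hsplit := PercRepro.Matroid.eRk_eq_eRk_inter_add_encard_sdiff hX hr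
  rw [← hS₀] at hsplit
  have hXfin : X.Finite := M.ground_finite.subset hX
  have hDfin : (X \ S₀).Finite := hXfin.subset sdiff_subset
  have hIfin : (X ∩ S₀).Finite := hXfin.subset Set.inter_subset_left
  by_contra hnot
  have hDpos : 1 ≤ (X \ S₀).ncard := by
    rw [Nat.one_le_iff_ne_zero, Ne, Set.ncard_eq_zero hDfin, Set.sdiff_eq_empty]
    exact hnot
  -- `|X| = |X ∩ S₀| + |X ∖ S₀|`
  have hcard : (X ∩ S₀).ncard + (X \ S₀).ncard = X.ncard := by
    have h := Set.ncard_inter_add_ncard_sdiff_eq_ncard X S₀ hXfin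
    exact h
  obtain ⟨r, hr'⟩ := exists_eRk_eq_nat (M := M) X
  obtain ⟨rI, hrI⟩ := exists_eRk_eq_nat (M := M) (X ∩ S₀)
  rw [hr'] at hr hsplit
  rw [hrI, ← hDfin.cast_ncard_eq] at hsplit
  have e1 : r ≤ 3 := by exact_mod_cast hr
  have e2 : r = rI + (X \ S₀).ncard := by exact_mod_cast hsplit
  -- `X ∩ S₀` has rank `≤ 2`, hence `≤ 3` points; and with more nullity, fewer
  have hI : (X ∩ S₀).ncard ≤ rI + 1 := by
    rcases Nat.lt_or_ge (X ∩ S₀).ncard 2 with hlt | hge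
    · omega
    rcases Nat.lt_or_ge (X ∩ S₀).ncard 4 with hlt4 | hge4
    · have := two_le_eRk_of_two_le_ncard hs (Set.inter_subset_left.trans hX) hge
      rw [hrI] at this
      have : 2 ≤ rI := by exact_mod_cast this
      omega
    · have := three_le_eRk_of_four_le_ncard hs hC1 (Set.inter_subset_left.trans hX) hge4
      rw [hrI] at this
      have : 3 ≤ rI := by exact_mod_cast this
      omega
  omega

end CoreFour
end PercRepro
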